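/-
Copyright (c) 2026 the pub-hodgecm-mathlib formalisation cell (harness21).  Prover seat hodgecm-mathlib-LH7-p09 (g3), CLOSE-OUT ROSTER strike line L3∕L5 (Track A
«(D-RAM) FOUR-FRAME» squad F0∕P3c∕LH4 ∕ F0∕P3c∕LH7); β₂ WORD #30 «LH7-p09: hL_mix_hi» ∕ WORD #29 (lower line); helper lane on h413 = stmt-HodgeConjecture-24833
(count-neutral).  2026-09-05.
-/
import Summits.HodgeConjecture.HodgeConjecture.Theorems.F0P3cDyRamStageOneBDefs             -- ★ DEFS: `mcOfRecord`, `mstarOfRecord`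
import Literature.NumberTheory.LocalFields.WildQuadraticDatumTraceBound                    -- ★ Lit: `trace_bound_pow_of_isRamifiedQuadraticDatum` (`|x + Θx| ≤ |ϖ|^{d−1}|x|`)
import HarnessLib

/-!
# Crux `H413`, line LH4 «(D-RAM) FOUR-FRAME» — STAGE-1b, row (2) of `f_{T₊}`, the (β₂) road (R-36), (OFF) residue, THE LOWER LINE: «THE SIZE LETTERS OF A LOWER-LINE CELL AT
# AND ABOVE THE GLUE CONDUCTOR» — the inputs `hμle hanti g1 g2 g3 gsk` of ★ p863761 ∕ ★ `…LowerLineVertexReads` ∕ ★ p864303, read off the (OFF) block scalars on ANY lower-line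
# cell `1 ≤ b < j`, `2b + ℓ₀ < m`, `j + b + ℓ₀ = jl` under the floor `m_c ≤ m`, for EVERY `b ≥ d` (RAY and MIX-hi alike), with the SHARP bound `|Θα − α| ≤ |ϖE|^{d−1}`

Cell `hodgecm-mathlib` (D-0151), FLOOR 0, crux item H413 = `stmt-HodgeConjecture-24833`, route of record `HCCMUnconditional`; squads F0∕P3c∕LH4 ∕ LH7; lane
`--supports stmt-HodgeConjecture-24833 --as helper` (count-neutral; pays NO tier-0 row).  THEOREMS ONLY (no `def`, no instance, no notation, no `sorry`, default heartbeats);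
★-only imports; states NO law.  DATUM-LIGHT: a valued field `M` with the `Θ`-datum `IsRamifiedQuadraticDatum Θ ϖM d t` (= the block's `_hDM` at `ϖM = jE ϖ`), `ρ`, `α`.

WHY (★ p864044's letter derivations use `|Θα − α| ≤ exp(−1)`, which feeds ★ p863761's size `g2 : |μ|·|Θα − α| ≤ |α − ρα|·|ϖE|^b·|ϖE|^{m⋆}` only for `b + 1 ≤ d`, `b = d`
or `b ≥ 2d − 3`; the strip `d < b < 2d − 3` of the MIX-hi band (non-empty from `d = 5`) needs the sharp bound).  THIS FILE:
* §1 `v_two_le_pow_pred_of_datum` — `|2| ≤ |ϖM|^{d−1}` (`2ϖM = (ϖM + ΘϖM) + (ϖM − ΘϖM)`, ★ Lit trace bound + the datum's `|ϖM − ΘϖM| = |ϖM|^d`);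
  `v_theta_sub_le_pow_pred_of_datum` — `|α| ≤ 1 ⇒ |Θα − α| ≤ |ϖM|^{d−1}` (`Θα − α = (α + Θα) − 2α`).
* §2 HEAD `lowerLine_sizeLetters_of_le` — from `|μ| = exp(−m)`, `|μ − ρμ| = exp(−jl)`, `|α − ρα| = 1`, `|ϖM| = exp(−1)`, `|α| ≤ 1`, the `Θ`-datum, the cell `1 ≤ b < j`,
  `2b + d%2 < m`, `j + b + d%2 = jl`, `d ≤ b` and the floor `mcOfRecord d ≤ m`: the six letters `hμle`, `hanti`, `g1`, `g2`, `g3`, `gsk` (at `n := mcOfRecord d`) of ★ p863761's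
  HEAD in the cell currency `cc = ϖM^j`, and `3d − 2 + d%2 ≤ mcOfRecord d`.
HONEST LABEL.  Count-neutral valuation bookkeeping; nothing printed is asserted; no census law is stated; `HC_CM` is proved only modulo the 7 printed citations (2 remaining named inputs:
hLiu418 = `stmt-HodgeConjecture-24832`, h413 = `stmt-HodgeConjecture-24833`) until rung 0 closes.
## References
* [Serre1979] J.-P. Serre, *Local Fields*, GTM 67 (1979): Ch. III §6 Prop. 12 (orders of conductor `c`), Ch. III §3 Prop. 7 (trace and different), Ch. V §3 Cor. 3.
* [Kottwitz1986BaseChangeUnits] R. E. Kottwitz, *Base change for unit elements of Hecke algebras*, Compositio Math. 60 (1986): §1 pp. 240–241.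
* [Rogawski1990] J. D. Rogawski, *Automorphic Representations of Unitary Groups in Three Variables*, Ann. of Math. Stud. 123 (1990): §4.9 Prop. 4.9.1 (b) p. 55.
-/

set_option autoImplicit false

noncomputable section

namespace Summit.HodgeConjecture.HodgeConjecture.Cruxes.H413.F0P3cDyRamLowerLineSizeLettersAbove

open scoped Valued WithZero
open WithZero
open Literature.NumberTheory.Automorphic.UnitaryThreeFourFrame (IsRamifiedQuadraticDatum)
open Literature.NumberTheory.LocalFields.WildQuadraticDatum (trace_bound_pow_of_isRamifiedQuadraticDatum)
open Summit.HodgeConjecture.HodgeConjecture.Cruxes.H413.F0P3cDyRamFourFramePieces (mstarOfRecord)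
open Summit.HodgeConjecture.HodgeConjecture.Cruxes.H413.F0P3cDyRamStageOneBDefs (mcOfRecord)

variable {M : Type} [Field M] [Valued M ℤᵐ⁰] {ρ Θ : M →+* M} {α : M}

/-! ## §1 The sharp bound `|Θα − α| ≤ |ϖM|^{d−1}` -/

/-- **`|2| ≤ |ϖM|^{d−1}` AT A RAMIFIED QUADRATIC DATUM** (`2·ϖM = (ϖM + ΘϖM) + (ϖM − ΘϖM)`, ★ Lit trace bound and `|ϖM − ΘϖM| = |ϖM|^d`). [cite: Serre1979, Ch. III §3 Prop. 7] -/
theorem v_two_le_pow_pred_of_datum {ϖM : M} {d t : ℕ} (hDM : IsRamifiedQuadraticDatum Θ ϖM d t) : Valued.v (2 : M) ≤ Valued.v ϖM ^ (d - 1) := by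
  obtain ⟨-, -, hϖ, -, hdiff, hd1, -⟩ := id hDM
  have hϖ0 : Valued.v ϖM ≠ 0 := by rw [hϖ]; exact exp_ne_zero
  have hsum : Valued.v (ϖM + Θ ϖM) ≤ Valued.v ϖM ^ (d - 1) * Valued.v ϖM := trace_bound_pow_of_isRamifiedQuadraticDatum hDM ϖM
  have e : (2 : M) * ϖM = (ϖM + Θ ϖM) + (ϖM - Θ ϖM) := by ring
  have hle : Valued.v ((2 : M) * ϖM) ≤ Valued.v ϖM ^ (d - 1) * Valued.v ϖM := by
    rw [e]
    refine (Valuation.map_add _ _ _).trans (max_le hsum ?_)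
    rw [hdiff, ← pow_succ, show d - 1 + 1 = d by omega]
  rw [Valuation.map_mul] at hle
  exact le_of_mul_le_mul_right hle (zero_lt_iff.2 hϖ0)

/-- **THE SHARP BOUND `|Θα − α| ≤ |ϖM|^{d−1}`** for `|α| ≤ 1` (`Θα − α = (α + Θα) − 2α`; ★ Lit trace bound + `v_two_le_pow_pred_of_datum`). [cite: Serre1979, Ch. III §3 Prop. 7] -/
theorem v_theta_sub_le_pow_pred_of_datum {ϖM : M} {d t : ℕ} (hDM : IsRamifiedQuadraticDatum Θ ϖM d t) (hα1 : Valued.v α ≤ 1) :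
    Valued.v (Θ α - α) ≤ Valued.v ϖM ^ (d - 1) := by
  have e : Θ α - α = (α + Θ α) - 2 * α := by ring
  rw [e]
  refine (Valuation.map_sub _ _ _).trans (max_le ?_ ?_)
  · exact (trace_bound_pow_of_isRamifiedQuadraticDatum hDM α).trans (mul_le_of_le_one_right' hα1)
  · rw [Valuation.map_mul]
    exact (mul_le_mul' (v_two_le_pow_pred_of_datum hDM) hα1).trans (by rw [mul_one])

/-! ## §2 HEAD — the six size letters of a lower-line cell at and above the glue conductor -/

/-- **HEAD — «THE SIZE LETTERS OF A LOWER-LINE CELL AT AND ABOVE THE GLUE CONDUCTOR».**  Scalars: `|μ| = exp(−m)`, `|μ − ρμ| = exp(−jl)`, `|α − ρα| = 1`, `|α| ≤ 1`,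
`|ϖM| = exp(−1)` (part of the `Θ`-datum `hDM`); cell: `1 ≤ b < j`, `2b + d%2 < m`, `j + b + d%2 = jl`, `d ≤ b`; floor `mcOfRecord d ≤ m`.  THEN, with `cc = ϖM^j`,
`hμle : |μ| ≤ |ϖM|^{2b+d%2+1}`, `hanti : |μ − ρμ| = |cc(α − ρα)|·|ϖM|^{b+d%2}`, `g1 : |μ|·|ϖM|^{d−1} ≤ |α − ρα|·|ϖM|^b·|ϖM|^{m⋆}`, `g2 : |μ|·|Θα − α| ≤ …`, `g3 : |μ|·|cc| ≤ …`,
`gsk : |μ|·|μ − ρμ| ≤ |ϖM|^{m_c}·|cc(α − ρα)|·|ϖM|^b`, and `3d − 2 + d%2 ≤ mcOfRecord d` (`m⋆ = mstarOfRecord d = d%2 + 2d − 1`).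
[cite: Serre1979, Ch. III §6 Prop. 12] [cite: Kottwitz1986BaseChangeUnits, §1 pp. 240–241] [cite: Rogawski1990, §4.9 Prop. 4.9.1 (b) p. 55] -/
theorem lowerLine_sizeLetters_of_le {ϖM μ : M} {d t m jl j b : ℕ} (hDM : IsRamifiedQuadraticDatum Θ ϖM d t) (hα1 : Valued.v α ≤ 1) (hU : Valued.v (α - ρ α) = 1)
    (hm : Valued.v μ = exp (-(m : ℤ))) (hjl : Valued.v (μ - ρ μ) = exp (-(jl : ℤ)))
    (hb1 : 1 ≤ b) (hbj : b < j) (h2bm : 2 * b + d % 2 < m) (hline : j + b + d % 2 = jl) (hdb : d ≤ b) (hmcm : mcOfRecord d ≤ m) :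
    Valued.v μ ≤ Valued.v ϖM ^ (2 * b + d % 2 + 1) ∧
    Valued.v (μ - ρ μ) = Valued.v (ϖM ^ j * (α - ρ α)) * Valued.v ϖM ^ (b + d % 2) ∧
    Valued.v μ * Valued.v ϖM ^ (d - 1) ≤ Valued.v (α - ρ α) * Valued.v ϖM ^ b * Valued.v ϖM ^ mstarOfRecord d ∧
    Valued.v μ * Valued.v (Θ α - α) ≤ Valued.v (α - ρ α) * Valued.v ϖM ^ b * Valued.v ϖM ^ mstarOfRecord d ∧
    Valued.v μ * Valued.v (ϖM ^ j) ≤ Valued.v (α - ρ α) * Valued.v ϖM ^ b * Valued.v ϖM ^ mstarOfRecord d ∧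
    Valued.v μ * Valued.v (μ - ρ μ) ≤ Valued.v ϖM ^ mcOfRecord d * Valued.v (ϖM ^ j * (α - ρ α)) * Valued.v ϖM ^ b ∧
    3 * d - 2 + d % 2 ≤ mcOfRecord d := by
  obtain ⟨-, -, hϖ, -, -, hd1, -⟩ := id hDM
  have hPn : ∀ n : ℕ, Valued.v ϖM ^ n = exp (-(n : ℤ)) := fun n => by
    rw [hϖ, ← exp_nsmul]; congr 1; simp
  have hms : mstarOfRecord d = d % 2 + 2 * d - 1 := rfl
  have hmc : mcOfRecord d = 2 * ((mstarOfRecord d + d) / 2) := rfl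
  have hn : 3 * d - 2 + d % 2 ≤ mcOfRecord d := by rw [hmc, hms]; omega
  have hmcv : 3 * d - 2 + d % 2 ≤ m := hn.trans hmcm
  refine ⟨?_, ?_, ?_, ?_, ?_, ?_, hn⟩
  · rw [hm, hPn, exp_le_exp]; omega
  · rw [hjl, Valuation.map_mul, hU, mul_one, Valuation.map_pow, hPn, hPn, ← exp_add]; congr 1; omega
  · rw [hm, hU, one_mul, hPn, hPn, hPn, ← exp_add, ← exp_add, exp_le_exp]; omega
  · calc Valued.v μ * Valued.v (Θ α - α)
        ≤ exp (-(m : ℤ)) * Valued.v ϖM ^ (d - 1) := by rw [hm]; exact mul_le_mul' le_rfl (v_theta_sub_le_pow_pred_of_datum hDM hα1)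
      _ ≤ Valued.v (α - ρ α) * Valued.v ϖM ^ b * Valued.v ϖM ^ mstarOfRecord d := by
        rw [hU, one_mul, hPn, hPn, hPn, ← exp_add, ← exp_add, exp_le_exp]; omega
  · rw [hm, hU, one_mul, Valuation.map_pow, hPn, hPn, hPn, ← exp_add, ← exp_add, exp_le_exp]; omega
  · rw [hm, hjl, Valuation.map_mul, hU, mul_one, Valuation.map_pow, hPn, hPn, hPn, ← exp_add, ← exp_add, ← exp_add, exp_le_exp]; omega

end Summit.HodgeConjecture.HodgeConjecture.Cruxes.H413.F0P3cDyRamLowerLineSizeLettersAbove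

end
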